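import Summits.HodgeConjecture.HodgeConjecture.Theorems.Ring2BindersAbelianSchemeVHCNodes
import Summits.Ventures.HSemireg.AmplificationChainAssembly
import Literature.AlgebraicGeometry.HodgeTheory.SupportedLocusClosed
import Literature.AlgebraicGeometry.HodgeTheory.DirectImageBaseChangeSections
import HarnessLib

/-!
# Ring 2 — road b02 («variational Hodge for abelian schemes», binder `Ring2.Hypotheses.AbelianSchemeVHC`):
the typed crux «admissible (semiregular) representatives exist» and its kernel-checked assembly to `HC_AV`

research route conditional on HC_CM; not a corollary; Q11.4-sentence-2 already refuted in dim ≥ 3.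
(Cell framing line of pub-hodge-ring2; in THIS file `HC_CM` = `Theses.RankFourFaces.CMAbelianHodge` is consumed
NOWHERE — the road below is the HC_CM-free André-1996 closer.)

PROVENANCE. Mathematics and Lean text by cell `vhodge`, seat P4, generation g6
(`run/shared/lean/pub/vhodge/memos/ROUTE-P4-g6-Sketch.lean`, sha256/16 `2203ac593837a149`, farm rc 0 per
vhodge STATUS «2026-08-25T19:47:50Z»; memo `ROUTE-P4-g6.md`), re-homed VERBATIM (namespace only changed,
`VHodgeP4g6` → `Ring2.SemiregularRepresentatives`) under `Theorems/` by the ring-2 LEAD (typer1), the FILER of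
the b02 route under human ruling D-0059 (director-hodge «2026-08-25T18:38:50Z»), so that the route file
`Theses/VHCAbelianSchemesRoad.lean` can state its items BY NAME over tree declarations (a route file may import
only `Summits.<P>.Theorems.*`, Literature, Mathlib, HarnessLib). HONEST FRAMING: nothing here is asserted; every
`def … : Prop` is a HYPOTHESIS wherever used; Markman 2025 is not used; no node of the ring-2 lattice is claimed
closed. Supports `stmt-HodgeConjecture-16267` (`CMToAbelian`) as a helper: it types the missing input of its
registered stub `stub_abelianSchemeVHC`.

## The finding (g5 §3.3, made kernel-exact here)

* A route whose only crux is `AbelianSchemeVHC` is `HC_AV` restated: tree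
  `Ring2.Deform.HC_AV_iff_abelianSchemeVHC_of_andre1996` (modulo the two printed André-1996 facts).
* Every KNOWN technique for the variational Hodge conjecture (Bloch 1972, Buchweitz–Flenner 2003,
  Pridham 2024, Perry 2026, Bloch–Esnault–Kerz 2014 in char. 0) has the shape
  DOOR(𝒪): «an 𝒪-admissible datum on ONE fibre whose flat transports stay Hodge is algebraic on a
  neighbourhood» — typed once for all object classes `𝒪` by cell pub-hsemireg as
  `Summit.Ventures.HSemireg.LocalVariationalHodgeFor 𝒪` (for `𝒪 = bfSheafClass C` it IS the tree fact
  `BuchweitzFlenner2003_variationalHodge_ISemiregular_model`, BF Thm. 5.1).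
* Hence «b02 by known VHC techniques» ⟺ the ONE genuinely new statement
  `AdmissibleRepresentatives 𝒪` below: on a fibre of a one-parameter abelian scheme, every algebraic
  class whose global extension is fibrewise Hodge has — up to a non-zero scalar and a fibrewise-algebraic
  global correction — an `𝒪`-admissible representative whose side components are restrictions of
  fibrewise-Hodge global classes. THIS is what b02 needs «beyond codimension 1 / semiregular classes»;
  it is NOT implied by `HC_AV` (a distinct conjecture), and all evidence of record at the Weil nodes is
  negative (hsemireg NEG #1–#16, 0 admissible objects in 218 + … design rows; vhodge COR R).

## Contents (all sorry-free)

* §1 `AdmissibleRepresentatives 𝒪` — the crux, over the binders of ring 2's germ node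
  `Ring2.Binders.OneParameterAbelianSchemeVHCGerm` VERBATIM.
* §2 `oneParameterAbelianSchemeVHCGerm_of` : `LocalVariationalHodgeFor 𝒪 → AdmissibleRepresentatives 𝒪 →
  OneParameterAbelianSchemeVHCGerm` (Ehresmann on `S(ℂ)`, flatness of restrictions of global classes,
  path component of `s₀` in the door's open set; the shape of hsemireg's
  `weilAnchorLocalClause_of_localVariationalHodgeFor_of_seedOn`, here for an ARBITRARY class).
* §3 `abelianSchemeVHC_of` : `… → OneParameterAbelianSchemeQuasiProjective → AbelianSchemeVHC`
  (ring 2's exactness `abelianSchemeVHC_iff_germ_of_oneParameterAbelianSchemeQuasiProjective`).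
* §4 `hc_av_of` : `… → andre1996_cmAnchoredPencil → andre1996_cmHodgeClasses_algebraicallyAnchoredPencils →
  HC_AV` (ring 2's `Deform.HC_AV_iff_abelianSchemeVHC_of_andre1996`; NO `HC_CM`, NO R3anc).
* §5 the SHEAF DOOR instance by name: `SemiregularSheafRepresentatives` (crux K-SR of the brief) and
  `hc_av_of_semiregularSheafRepresentatives` — `closes`-shaped, hypotheses = {crux, BF Thm. 5.1 (tree
  fact), curve residual (print), André 1996 Lemme 6.3.1, Lemmes 6.3.2–6.3.3 (tree facts)}.
-/

noncomputable section

open CategoryTheory AlgebraicGeometry Topology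

namespace Summit.HodgeConjecture.HodgeConjecture.Ring2.SemiregularRepresentatives

set_option linter.dupNamespace false

open Literature.AlgebraicGeometry Literature.AlgebraicGeometry.Motives
open Literature.AlgebraicGeometry.HodgeTheory
open Literature.AlgebraicTopology.SingularHomology
open Literature.AlgebraicGeometry.Andre1996 (andre1996_cmAnchoredPencil
  andre1996_cmHodgeClasses_algebraicallyAnchoredPencils)
open Summit.HodgeConjecture.HodgeConjecture.Ring2.Hypotheses (AbelianSchemeVHC)
open Summit.HodgeConjecture.HodgeConjecture.Ring2.Binders
open Summit.Ventures.HSemireg (ObjClass LocalVariationalHodgeFor bfSheafClass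
  localVariationalHodgeFor_bfSheafClass)

/-! ## §1 The crux: admissible representatives on fibres of one-parameter abelian schemes -/

/-- **`AdmissibleRepresentatives 𝒪` — road b02's missing input for the object class `𝒪`** (crux; OPEN;
a HYPOTHESIS wherever used). Binders = those of `Ring2.Binders.OneParameterAbelianSchemeVHCGerm` verbatim
(`f : 𝒳 ⟶ S` smooth projective of relative dimension `n`, `𝒳` quasi-projective, `S` a smooth irreducible
affine curve, all complex fibres abelian varieties, a section, a global class `W ∈ H²ᵖ(𝒳(ℂ);ℂ)` fibrewise
rational of type `(p,p)`, a point `s₀` with `W|_{𝒳_{s₀}}` algebraic). Conclusion: there are a finite set of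
degrees `I ∋ p`, classes `κ_q ∈ H^{2q}(𝒳_{s₀})` ADMISSIBLE for `𝒪` in relative dimension `n`
(`𝒪 n 𝒳_{s₀} I κ` — e.g. the Chern character components of an `I`-semiregular sheaf), global classes
`V_q ∈ H^{2q}(𝒳(ℂ);ℂ)` fibrewise of type `(q,q)` restricting to `κ_q` at `s₀` (`q ∈ I`), and a scalar
`a ≠ 0` and a FIBREWISE-ALGEBRAIC global class `Z` with `V_p = a·W + Z` (Bloch's Remark (7.5) form
`a·z₀ + b·l₀ᵖ`). For every door `𝒪` with `LocalVariationalHodgeFor 𝒪` this gives the germ node (§2).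
Not implied by `HC_AV`; at the Weil nodes all evidence of record is negative (hsemireg NEG #1–#16).
[cite: Bloch1972Semiregularity, Remark (7.5) and Thm. (7.4)] [cite: BuchweitzFlenner2003, §5 Thm. 5.1]
[cite: Grothendieck1966, footnote 13] -/
@[conjecture] def AdmissibleRepresentatives (𝒪 : ObjClass) : Prop :=
  ∀ ⦃n : ℕ⦄ ⦃𝒳 S : SchemeOver ℂ⦄ (f : 𝒳 ⟶ S), IsSmoothProjectiveFamily f n → IsQuasiProjectiveOver 𝒳 →
    IrreducibleSpace S.left → IsAffine S.left → AlgebraicGeometry.Smooth S.hom → topologicalKrullDim S.left = 1 →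
    (∀ s : ComplexPoints S, ∃ A' : AbelianVariety ℂ, A'.dim = n ∧ Nonempty (A'.X ≅ fiberOver f s)) →
    (∃ e : S ⟶ 𝒳, e ≫ f = 𝟙 S) →
    ∀ (p : ℕ) (W : complexBetti 𝒳 (2 * p)),
      (∀ s : ComplexPoints S, IsRationalClass (complexBetti.map (fiberι f s) (2 * p) W) ∧
        IsOfHodgeType n (fiberOver f s) (2 * p) p p (complexBetti.map (fiberι f s) (2 * p) W)) →
      ∀ s₀ : ComplexPoints S,
        complexBetti.map (fiberι f s₀) (2 * p) W ∈ algebraicClasses (fiberOver f s₀) p →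
        ∃ (I : Finset ℕ) (κ : (q : ℕ) → complexBetti (fiberOver f s₀) (2 * q))
          (V : (q : ℕ) → complexBetti 𝒳 (2 * q)) (a : ℂ) (Z : complexBetti 𝒳 (2 * p)),
          p ∈ I ∧ 𝒪 n (fiberOver f s₀) I κ ∧ a ≠ 0 ∧
          (∀ s : ComplexPoints S, complexBetti.map (fiberι f s) (2 * p) Z ∈ algebraicClasses (fiberOver f s) p) ∧
          V p = a • W + Z ∧
          (∀ q ∈ I, κ q = complexBetti.map (fiberι f s₀) (2 * q) (V q)) ∧
          (∀ q ∈ I, ∀ s : ComplexPoints S,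
            IsOfHodgeType n (fiberOver f s) (2 * q) q q (complexBetti.map (fiberι f s) (2 * q) (V q)))

/-- Admissible representatives for a narrower object class are admissible representatives for any wider
one. [folklore] -/
theorem AdmissibleRepresentatives.mono {𝒪 𝒪' : ObjClass} (h𝒪 : ∀ n X₀ I κ, 𝒪 n X₀ I κ → 𝒪' n X₀ I κ)
    (h : AdmissibleRepresentatives 𝒪) : AdmissibleRepresentatives 𝒪' := by
  intro n 𝒳 S f hf h𝒳 hirr haff hsm hdim habel he p W hW s₀ hs₀
  obtain ⟨I, κ, V, a, Z, hpI, hκ, ha, hZ, hVp, hκV, hVH⟩ := h f hf h𝒳 hirr haff hsm hdim habel he p W hW s₀ hs₀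
  exact ⟨I, κ, V, a, Z, hpI, h𝒪 _ _ _ _ hκ, ha, hZ, hVp, hκV, hVH⟩

/-! ## §2 Crux + door ⟹ ring 2's germ node -/

/-- Functoriality bookkeeping: the identity isomorphism acts trivially on Betti cohomology
(`complexBetti.map (Iso.refl X).inv = id`). [folklore] -/
private theorem map_refl_inv (X : SchemeOver ℂ) (k : ℕ) (c : complexBetti X k) :
    complexBetti.map (Iso.refl X).inv k c = c := by
  rw [Iso.refl_inv, complexBetti.map_id]
  rfl

/-- **The local variational statement for `𝒪` and admissible representatives of class `𝒪` give the
germ form of b02 on one-parameter abelian schemes.** Proof: Ehresmann on `S(ℂ)`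
(`isCohomologicallyLocallyTrivialOn_univ_of_isSmoothProjectiveFamily_of_smooth`); the door applied at the
model `Iso.refl 𝒳_{s₀}` — its Hodge hypothesis holds because the transport of `κ_q = V_q|_{s₀}` along any
path is `V_q|_t` (`transportFun_map_fiberι`, flatness of restrictions of global classes); on the path
component of `s₀` in the door's open set (open: `S(ℂ)` is locally path connected,
`locallyPathConnectedSpace_complexPoints_of_smooth`) the transport of `κ_p` is `a·W|_t + Z|_t`, algebraic,
and `Z|_t` is algebraic, so `W|_t` is. [cite: BuchweitzFlenner2003, §5 Thm. 5.1 (argument shape)]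
[cite: VoisinHodgeI2002, §9.2.1 and Thm. 9.3] -/
theorem oneParameterAbelianSchemeVHCGerm_of {𝒪 : ObjClass} (hT : LocalVariationalHodgeFor 𝒪)
    (hSR : AdmissibleRepresentatives 𝒪) : OneParameterAbelianSchemeVHCGerm := by
  intro n 𝒳 S f hf h𝒳 hirr haff hsm hdim habel he p W hW s₀ hs₀
  haveI := hirr
  haveI := hsm
  haveI : LocallyOfFiniteType S.hom := inferInstance
  haveI : LocallyPathConnectedSpace (ComplexPoints S) := locallyPathConnectedSpace_complexPoints_of_smooth S
  have hU : IsCohomologicallyLocallyTrivialOn f (Set.univ : Set (ComplexPoints S)) :=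
    isCohomologicallyLocallyTrivialOn_univ_of_isSmoothProjectiveFamily_of_smooth f hf
  obtain ⟨I, κ, V, a, Z, hpI, hκ, ha, hZ, hVp, hκV, hVH⟩ :=
    hSR f hf h𝒳 hirr haff hsm hdim habel he p W hW s₀ hs₀
  let s₀' : (Set.univ : Set (ComplexPoints S)) := ⟨s₀, Set.mem_univ s₀⟩
  -- the Hodge hypothesis of the door at the model `Iso.refl 𝒳_{s₀}`
  have hHodge : ∀ q ∈ I, ∀ (t : (Set.univ : Set (ComplexPoints S))) (γ : Path.Homotopic.Quotient s₀' t),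
      IsOfHodgeType n (fiberOver f t.1) (2 * q) q q
        (transportFun f (2 * q) hU γ (complexBetti.map (Iso.refl (fiberOver f s₀)).inv (2 * q) (κ q))) := by
    intro q hq t γ
    rw [map_refl_inv, hκV q hq, transportFun_map_fiberι f (2 * q) hU γ (V q)]
    exact hVH q hq t.1
  obtain ⟨W', hWo, hW'₀, hWU, hW'⟩ := hT f n hf hsm hU s₀' (fiberOver f s₀) (Iso.refl _) I κ hκ hHodge
  refine ⟨pathComponentIn W' s₀, hWo.pathComponentIn s₀, mem_pathComponentIn_self hW'₀, fun t ht ↦ ?_⟩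
  have hj : JoinedIn W' s₀ t := ht
  have hpm : ∀ u, hj.somePath u ∈ W' := hj.somePath_mem
  let γ : Path (⟨s₀, hW'₀⟩ : W') ⟨t, pathComponentIn_subset ht⟩ :=
    { toFun := fun u ↦ ⟨hj.somePath u, hpm u⟩
      continuous_toFun := hj.somePath.continuous.subtype_mk _
      source' := Subtype.ext hj.somePath.source
      target' := Subtype.ext hj.somePath.target }
  have hmem := hW' p hpI ⟨t, pathComponentIn_subset ht⟩ ⟦γ⟧
  have htr : transportFun f (2 * p) (hU.mono hWU hWo) ⟦γ⟧
      (complexBetti.map (Iso.refl (fiberOver f s₀)).inv (2 * p) (κ p)) =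
      a • complexBetti.map (fiberι f t) (2 * p) W + complexBetti.map (fiberι f t) (2 * p) Z := by
    rw [map_refl_inv, hκV p hpI, transportFun_map_fiberι f (2 * p) (hU.mono hWU hWo) ⟦γ⟧ (V p), hVp,
      map_add, map_smul]
  change transportFun f (2 * p) (hU.mono hWU hWo) ⟦γ⟧
      (complexBetti.map (Iso.refl (fiberOver f s₀)).inv (2 * p) (κ p)) ∈ _ at hmem
  rw [htr] at hmem
  have hW' : complexBetti.map (fiberι f t) (2 * p) W =
      a⁻¹ • ((a • complexBetti.map (fiberι f t) (2 * p) W + complexBetti.map (fiberι f t) (2 * p) Z) -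
        complexBetti.map (fiberι f t) (2 * p) Z) := by
    rw [add_sub_cancel_right, smul_smul, inv_mul_cancel₀ ha, one_smul]
  rw [hW']
  exact Submodule.smul_mem _ _ (Submodule.sub_mem _ hmem (hZ t))

/-! ## §3 … ⟹ row b02, modulo ring 2's curve print residual -/

/-- **Crux + door + the curve residual ⟹ `AbelianSchemeVHC`** (row b02): §2 composed with ring 2's
exactness `abelianSchemeVHC_iff_germ_of_oneParameterAbelianSchemeQuasiProjective` (curve sections through two
points; one algebraic fibre of a flat Hodge section on a curve forces all, via the countable-union structure
of the algebraicity locus). [cite: CharlesSchnell2014Notes, Conj. 11.3.1 and Prop. 11.3.11 (proof)]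
[cite: GortzWedhorn2023, Thm. 27.291] -/
theorem abelianSchemeVHC_of {𝒪 : ObjClass} (hT : LocalVariationalHodgeFor 𝒪)
    (hSR : AdmissibleRepresentatives 𝒪) (hqp : OneParameterAbelianSchemeQuasiProjective) : AbelianSchemeVHC :=
  (abelianSchemeVHC_iff_germ_of_oneParameterAbelianSchemeQuasiProjective hqp).mpr
    (oneParameterAbelianSchemeVHCGerm_of hT hSR)

/-! ## §4 … ⟹ `HC_AV`, with NO `HC_CM` and NO anchored-family leaf -/

/-- **Crux + door + curve residual + André 1996 Lemmes 6.3.1–6.3.3 ⟹ `HC_AV`** — the `closes`-shape of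
the b02 route for an arbitrary door `𝒪`: ring 2's `Deform.HC_AV_iff_abelianSchemeVHC_of_andre1996`
(Milne's endnote-19 theorem with André's compact pencils as anchors; `HC_CM` nowhere).
[cite: Andre1996Motifs, §6.3 Lemmes 6.3.1–6.3.3 and Remarque 2 (p. 33)]
[cite: Deligne1982HodgeCycles, Prop. 6.1 and Milne 2003 re-edition endnote 19] -/
theorem hc_av_of {𝒪 : ObjClass} (hT : LocalVariationalHodgeFor 𝒪) (hSR : AdmissibleRepresentatives 𝒪)
    (hqp : OneParameterAbelianSchemeQuasiProjective) (h₂₁ : andre1996_cmAnchoredPencil)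
    (h₂₂ : andre1996_cmHodgeClasses_algebraicallyAnchoredPencils) :
    Theses.PadicSemiregularLift.HodgeAbelianVarieties :=
  (Ring2.Deform.HC_AV_iff_abelianSchemeVHC_of_andre1996 h₂₁ h₂₂).mpr (abelianSchemeVHC_of hT hSR hqp)

/-! ## §5 The SHEAF door by name (Buchweitz–Flenner Thm. 5.1, tree fact): the items K-SR and K-C of the brief

TYPING (tree idiom, `Literature/…/ChernCharacterBetti.lean` module doc): consumers take the Chern character theory
`(C : ChernCharacterBetti)` as a PARAMETER and there is deliberately NO existence fact `Nonempty ChernCharacterBetti`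
(a CONSTRUCTION owed to the tree: Chern classes of algebraic vector bundles in Betti cohomology with Fulton's laws).
So the crux is stated `∀ C` (every lawful theory; invariant under the rescalings `ch_q ↦ λ^q ch_q` of
`ChernCharacterBettiRescale.lean` because `a` and the `V q` absorb scalars) and the construction is a SEPARATE item
`ChernCharacterOnBetti` (never smuggled into the interface; the same construction stub as the registered line
`Cruxes/HodgeSimilitudeAlgebraic/Lines/semiregular-twin-hecke-vhc.lean :: stub_ChernCharacterOnBetti`). -/

/-- **K-SR `SemiregularSheafRepresentatives` — crux (rank 2) of the b02 brief**: admissible representatives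
exist for the Buchweitz–Flenner SHEAF class in EVERY Chern character theory `C` — i.e. on a fibre `𝒳_{s₀}`
of a one-parameter abelian scheme (ring-2 germ-node binders verbatim), every algebraic class `W|_{𝒳_{s₀}}` of a
fibrewise rational `(p,p)` global class `W` is, up to `a ≠ 0` and a fibrewise-algebraic global correction `Z`,
`ch_p(ℰ₀)` of a finite locally free `I`-semiregular `ℰ₀` (`p ∈ I`) whose other Chern character components
`ch_q(ℰ₀)`, `q ∈ I`, are restrictions of fibrewise `(q,q)` global classes. OPEN; not implied by `HC_AV`;
negative at every Weil node tried (hsemireg NEG #1–#16: 0 semiregular sheaf candidates in 218 + 8 design rows).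
WHY IT MIGHT FAIL: `I`-semiregularity forces the obstruction space `Ext²(ℰ₀,ℰ₀)` to inject into
`⊕_{q∈I} H^{q+1}(Ω^{q-1})` (dimension `Σ C(n,q+1)·C(n,q-1)` on an abelian `n`-fold), which at a generic Weil
fibre excludes every construction of record (vhodge COR R: 16 Weil directions needed at `n = 4`, ≤ 12 supplied).
[cite: BuchweitzFlenner2003, §5 Thm. 5.1 and Def. 4.10] [cite: Bloch1972Semiregularity, Remark (7.5)]
[cite: Grothendieck1966, footnote 13] -/
@[conjecture] def SemiregularSheafRepresentatives : Prop :=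
  ∀ C : ChernCharacterBetti, AdmissibleRepresentatives (bfSheafClass C)

/-- **K-C `ChernCharacterOnBetti` — construction item (rank 3) of the b02 brief**: a Chern character theory on
complex Betti cohomology with Fulton's laws EXISTS (the intended instance: `cl ∘ ch`, Fulton Ex. 3.2.3 / §15.1 /
Prop. 19.1.2; Voisin Thm. 11.23). A CONSTRUCTION the tree does not have (module doc of
`ChernCharacterBetti.lean`: "to be supplied by a construction … which is a theory the tree does not have, not a
lemma"); load-bearing because the sheaf door and K-SR are parametrised by `C`. WHY IT MIGHT FAIL: only as
TYPED — a law of the structure quantifying over all `SchemeOver ℂ` / all `Modules` could be jointly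
unsatisfiable (the rescaling audit `ChernCharacterBettiRescale.lean` found none). [cite: Fulton1998, Example 3.2.3
and §15.1] [cite: VoisinHodgeI2002, Thm. 11.23] -/
@[conjecture] def ChernCharacterOnBetti : Prop :=
  Nonempty ChernCharacterBetti

/-- **`closes`-shape of the b02 route through the sheaf door**:
`ChernCharacterOnBetti → SemiregularSheafRepresentatives → BF Thm. 5.1 (tree fact) → curve residual → André #21 →
André #22 → HC_AV`. Hypotheses = the brief's items {K-C (construction), K-SR (crux), F-BF (Literature fact, by
name), R-QP (print residual), F-A21, F-A22 (Literature facts, by name)}; conclusion = the H1 rung closer of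
record `Theses.PadicSemiregularLift.HodgeAbelianVarieties`. [cite: BuchweitzFlenner2003, §5 Thm. 5.1]
[cite: Andre1996Motifs, §6.3 Lemmes 6.3.1–6.3.3] -/
theorem hc_av_of_semiregularSheafRepresentatives (hC : ChernCharacterOnBetti)
    (hSR : SemiregularSheafRepresentatives)
    (hBF : BuchweitzFlenner2003_variationalHodge_ISemiregular_model)
    (hqp : OneParameterAbelianSchemeQuasiProjective) (h₂₁ : andre1996_cmAnchoredPencil)
    (h₂₂ : andre1996_cmHodgeClasses_algebraicallyAnchoredPencils) :
    Theses.PadicSemiregularLift.HodgeAbelianVarieties := by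
  obtain ⟨C⟩ := hC
  exact hc_av_of (localVariationalHodgeFor_bfSheafClass hBF C) (hSR C) hqp h₂₁ h₂₂

/-- The same through `AbelianSchemeVHC` (row b02 itself), for the ring-2 dictionary.
[cite: BuchweitzFlenner2003, §5 Thm. 5.1] -/
theorem abelianSchemeVHC_of_semiregularSheafRepresentatives (hC : ChernCharacterOnBetti)
    (hSR : SemiregularSheafRepresentatives)
    (hBF : BuchweitzFlenner2003_variationalHodge_ISemiregular_model)
    (hqp : OneParameterAbelianSchemeQuasiProjective) : AbelianSchemeVHC := by
  obtain ⟨C⟩ := hC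
  exact abelianSchemeVHC_of (localVariationalHodgeFor_bfSheafClass hBF C) (hSR C) hqp

/-- **`HC_AV` does its part of the Clay statement unchanged** (sanity: the conclusion above IS the H1 rung
`∀ A : AbelianVariety ℂ, HodgeConjectureFor A.dim A.X`, by `rfl`). -/
example (h : Theses.PadicSemiregularLift.HodgeAbelianVarieties) (A : AbelianVariety ℂ) :
    HodgeConjectureFor A.dim A.X := h A

end Summit.HodgeConjecture.HodgeConjecture.Ring2.SemiregularRepresentatives

end
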